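import Literature.AlgebraicGeometry.Motives.HodgeThetaSubalgebraRealPlacesSl2
import Literature.AlgebraicGeometry.Motives.HodgeLieRankLowerBound
import HarnessLib

/-!
# CM criterion via the Hodge operator: `Lie Hg(H)` is abelian (`⊆ End_Hdg`) iff `Θ ∈ End_Hdg(V) ⊗ ℂ`

Family `hodge`, layer `Literature/AlgebraicGeometry/Motives` (abstract `ℚ`-Hodge structures; no geometry). Cell `pub-hodgecm2`
(COR-CM), seat `b27` (count-neutral own lane MT-REDUCTIVE); UNCONDITIONAL, theorems only (no definition, no named fact, D-0026);
no step towards a summit statement.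

PRINTED RESULT. D. Mumford, *A note of Shimura's paper "Discontinuous groups and abelian varieties"*, Math. Ann. 181 (1969) §2 /
P. Deligne, LNM 900 (1982), I Ex. 3.7 and Prop. 3.4: an abelian variety (a polarizable Hodge structure) is of CM type iff its
Mumford–Tate group is a torus, iff `h : 𝕊 → GL(V_ℝ)` factors through the units of a commutative semisimple subalgebra of
`End_Hdg(V)`. Infinitesimally: the Hodge operator `Θ` (the differential of `h|U(1)`, `p - q` on `V^{p,q}`) lies in
`End_Hdg(V) ⊗ ℂ`. In the tree «CM» for a Hodge structure is `Lie Hg ⊆ End_Hdg(V)` (`hodgeLie_le_endAlg_iff`: iff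
`𝔪𝔱 ⊆ End_Hdg`, iff `𝔪𝔱` abelian; for `H¹` of an abelian variety iff `IsOfCMType`, `CorCM/MumfordTateLieAlgebraOfCMType`).

RESULTS (any weight; `spanC W = span_ℂ {a_ℂ : a ∈ W}`):
* **`hodgeLie_le_endAlg_of_theta_mem_spanC_endAlg`** — if SOME Hodge operator `Θ` lies in `spanC End_Hdg(V)` then
  `Lie Hg ⊆ End_Hdg(V)`: every `X ∈ Lie Hg` commutes with `End_Hdg(V)` (`commute_of_mem_hodgeLie`), hence with `Θ`, hence
  preserves the Hodge pieces (`ThetaSubalgebra.mem_endAlg_of_forall_commute` with `𝔤 = End_Hdg`). NO minimality of `Hg` is used.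
* `theta_mem_spanC_endAlg_of_hodgeLie_le_endAlg` — conversely `Θ ∈ (Lie Hg)_ℂ ⊆ spanC End_Hdg`.
* **`hodgeLie_le_endAlg_iff_exists_theta_mem_spanC_endAlg`** — the criterion as an iff;
  `mumfordTateLieAlgebra_le_endAlg_iff_exists_theta_mem_spanC_endAlg` — the same for `𝔪𝔱`.
-/

noncomputable section

open scoped TensorProduct

namespace Literature.AlgebraicGeometry.Motives

namespace HodgeStructure

universe u

variable {V : Type u} [AddCommGroup V] [Module ℚ V] [Module.Finite ℚ V] [HodgeTensorFacts.{u, u}] {n : ℤ}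

/-- **If a Hodge operator lies in `End_Hdg(V) ⊗ ℂ`, then `Lie Hg(H) ⊆ End_Hdg(V)`** (any weight): `X ∈ Lie Hg` commutes with
every Hodge endomorphism, hence `X_ℂ` commutes with `Θ ∈ spanC End_Hdg(V)`, hence `X_ℂ` preserves the eigenspaces `V^{p,q}` of
`Θ`, i.e. `X` is a Hodge endomorphism. Mumford's / Deligne's CM criterion, infinitesimal form, direction «`h` through `End` ⟹
`MT` commutative». [cite: Deligne1982HodgeCycles, I §3 Prop. 3.4] [cite: MoonenZarhin1999LowDim, §2] -/
theorem hodgeLie_le_endAlg_of_theta_mem_spanC_endAlg (H : HodgeStructure V n) {Θ : Module.End ℂ (ℂ ⊗[ℚ] V)}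
    (hΘ : ∀ p, ∀ x ∈ H.piece p (n - p), Θ x = ((2 * p - n : ℤ) : ℂ) • x)
    (hΘE : Θ ∈ spanC (Subalgebra.toSubmodule H.endAlg)) :
    H.hodgeLie ≤ Subalgebra.toSubmodule H.endAlg := by
  intro X hX
  rw [Subalgebra.mem_toSubmodule]
  exact ThetaSubalgebra.mem_endAlg_of_forall_commute H (Subalgebra.toSubmodule H.endAlg) hΘ hΘE
    fun a ha => H.commute_of_mem_hodgeLie hX ⟨a, (Subalgebra.mem_toSubmodule _).1 ha⟩

/-- **Conversely, if `Lie Hg(H) ⊆ End_Hdg(V)` then EVERY Hodge operator lies in `End_Hdg(V) ⊗ ℂ`** (`Θ ∈ (Lie Hg)_ℂ`,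
`mem_hodgeLieC_of_forall_piece`). [cite: Deligne1982HodgeCycles, I §3 Prop. 3.4] -/
theorem theta_mem_spanC_endAlg_of_hodgeLie_le_endAlg (H : HodgeStructure V n)
    (hle : H.hodgeLie ≤ Subalgebra.toSubmodule H.endAlg) {Θ : Module.End ℂ (ℂ ⊗[ℚ] V)}
    (hΘ : ∀ p, ∀ x ∈ H.piece p (n - p), Θ x = ((2 * p - n : ℤ) : ℂ) • x) :
    Θ ∈ spanC (Subalgebra.toSubmodule H.endAlg) := by
  have h : Θ ∈ spanC H.hodgeLie := by rw [← hodgeLieC_eq_spanC]; exact H.mem_hodgeLieC_of_forall_piece hΘ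
  exact Submodule.span_mono (Set.image_mono hle) h

/-- **CM criterion via `Θ`**: `Lie Hg(H) ⊆ End_Hdg(V)` (the Hodge Lie algebra is abelian — «`H` is of CM type») iff some
(equivalently every) Hodge operator lies in `End_Hdg(V) ⊗ ℂ`. [cite: Deligne1982HodgeCycles, I §3 Prop. 3.4]
[cite: MoonenZarhin1999LowDim, §2] -/
theorem hodgeLie_le_endAlg_iff_exists_theta_mem_spanC_endAlg (H : HodgeStructure V n) :
    H.hodgeLie ≤ Subalgebra.toSubmodule H.endAlg ↔
      ∃ Θ : Module.End ℂ (ℂ ⊗[ℚ] V), (∀ p, ∀ x ∈ H.piece p (n - p), Θ x = ((2 * p - n : ℤ) : ℂ) • x) ∧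
        Θ ∈ spanC (Subalgebra.toSubmodule H.endAlg) := by
  constructor
  · intro hle
    obtain ⟨Θ, hΘ⟩ := exists_hodgeTheta H
    exact ⟨Θ, hΘ, theta_mem_spanC_endAlg_of_hodgeLie_le_endAlg H hle hΘ⟩
  · rintro ⟨Θ, hΘ, hΘE⟩
    exact hodgeLie_le_endAlg_of_theta_mem_spanC_endAlg H hΘ hΘE

/-- **The same criterion for the Mumford–Tate Lie algebra**: `𝔪𝔱 ⊆ End_Hdg(V)` (`𝔪𝔱` abelian) iff a Hodge operator lies in
`End_Hdg(V) ⊗ ℂ` (`hodgeLie_le_endAlg_iff`). [cite: Deligne1982HodgeCycles, I §3 Prop. 3.4] [cite: MoonenZarhin1999LowDim, §2] -/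
theorem mumfordTateLieAlgebra_le_endAlg_iff_exists_theta_mem_spanC_endAlg (H : HodgeStructure V n) :
    H.mumfordTateLieAlgebra ≤ Subalgebra.toSubmodule H.endAlg ↔
      ∃ Θ : Module.End ℂ (ℂ ⊗[ℚ] V), (∀ p, ∀ x ∈ H.piece p (n - p), Θ x = ((2 * p - n : ℤ) : ℂ) • x) ∧
        Θ ∈ spanC (Subalgebra.toSubmodule H.endAlg) := by
  rw [← hodgeLie_le_endAlg_iff, hodgeLie_le_endAlg_iff_exists_theta_mem_spanC_endAlg]

end HodgeStructure

end Literature.AlgebraicGeometry.Motives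

end
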